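import Literature.Barriers.PneNP.NaturalProofsTC0
import Literature.Computability.Cryptography.NaorReingoldDDH
import HarnessLib

/-!
# Barrier catalogue `PneNP`: no natural proofs against `TC⁰` under subexponential DDH
(Naor–Reingold 2004, p. 237) — the CONDITIONAL form of `HardPRFInTC0`

D-0021 barrier entry for the summit `PneNP`, companion of
`Literature.Barriers.PneNP.NaturalProofsTC0`. That file PROVES the class-relative
Razborov–Rudich theorem (`not_natural_useful_of_hardPRF`: a keyed family in `Λ` with
superexponentially hard truth-table generators kills every `P/poly`-natural property useful
against `Λ`) and records the number-theoretic input as the bare `Prop`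

  `HardPRFInTC0 := ∃ key F, FamilyIn TC0 F ∧ SuperExpHard F`

("the Naor–Reingold hypothesis … Open / conditional; nothing asserted"), consumed as a
hypothesis `(h : HardPRFInTC0)`.

**Discrepancy recorded here.** `HardPRFInTC0` is cited to Naor–Reingold 2004 (p. 7 = p. 237,
Thm. 4.5, §5), but it states the CONSEQUENT of what is printed there, unconditionally: the
existence of pseudo-random functions in `TC⁰` secure against subexponential adversaries. The
source proves only conditional statements — Thm. 4.1 (p. 245): "If the DDH-Assumption
(Assumption 3.1) holds, then … `|Pr[M^{f_{P,Q,g,ā}}(P,Q,g) = 1] - Pr[M^{R_{P,Q,g}}(P,Q,g) = 1]| <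
1/n^α`", with the quantitative "moreover" (p. 246: a `t(n)`-time distinguisher of advantage
`ε(n)` yields a `poly(n)·t(n)`-time DDH breaker of advantage `ε(n)/n`); Thm. 4.5 (p. 252: the
functions are in `TC⁰`, unconditional); and p. 237: "if the GDH-Assumption holds against a
subexponential-time adversary (and in particular if factoring is sufficiently hard), then there
are no Natural Proofs for separating `TC⁰` from P/poly." As an unconditional statement
`HardPRFInTC0` is an OPEN existence hypothesis (a sibling of `Literature.Computability.Cryptography.PRFExist`): by
the proved `not_exists_natural_useful_TC0` it is refuted by any natural proof against `TC⁰`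
(`not_hardPRFInTC0_of_natural_useful` below), e.g. by the property "circuit complexity
`> n^{log n}`", which is useful against every `n^c` and large, and whose constructivity is open
[cite: AroraBarakCC2009, Example 23.2 (PDF p. 587)] — it would follow from `NP ⊆ P/poly`, since
`MCSP ∈ NP` [cite: KabanetsCai2000, §2]. So `HardPRFInTC0` cannot be discharged from the
literature; what the literature gives is the implication vendored here:

* `HardPRFInTC0OfSubexpDDH : Prop := SubexpDDH → HardPRFInTC0` — the corrected (conditional)
  statement, with `Literature.Computability.Cryptography.SubexpDDH` the decisional Diffie–Hellman assumption against
  `2^{m^δ}`-size circuits for some instance sequence (`NaorReingoldDDH.lean`). A named fact — the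
  ONLY named fact of this file: its proof is Thm. 4.1's hybrid argument run with explicit
  modular-exponentiation circuits, hashing of group elements to bits (Lemma 4.2 / Thm. 4.3,
  p. 246), Thm. 4.5 (`TC⁰` evaluation, via iterated multiplication in `TC⁰`) and the
  Razborov–Rudich coupling `n = m^{δ/2}` (Arora–Barak §23.3). Its in-tree discharge is in progress
  under `Literature/Computability/Cryptography/NaorReingold*.lean`: Thm. 4.5 is PROVED
  (`Literature.Computability.Cryptography.NaorReingold2004_thm45_holds`, `NaorReingoldTC0Size.lean`),
  the truth-table hybrid bound of Thms. 4.1/4.3 is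
  `Literature.Computability.Cryptography.NaorReingold.Params.abs_uProb_seedTable_sub_uniform_le`
  (`NaorReingoldEnds.lean`), the keyed family is `Literature.Computability.Cryptography.NaorReingold.Seq.family`
  (`NaorReingoldFamily.lean`); the assembly `theorem hardPRFInTC0OfSubexpDDH_holds :
  HardPRFInTC0OfSubexpDDH` is to be APPENDED to this file (no import cycle: those files import
  `NaturalProofsTC0.lean`, not this one).
* `naturalProofsTC0_of_subexpDDH` — the sentence of p. 237 in the tree's vocabulary (DDH form),
  a THEOREM relative to the named fact: `(h : HardPRFInTC0OfSubexpDDH) → SubexpDDH →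
  ¬ ∃ P, IsNatural PPoly P ∧ IsUsefulAgainst TC0 P`, one line from the tree's proved
  `naturalProofsTC0_holds`; it carries the D-0021 barrier block. (Until 2026-08-15 this sentence
  was ALSO recorded as a second named fact `NaturalProofsTC0OfSubexpDDH : Prop` with the discharge
  `naturalProofsTC0OfSubexpDDH_of_hardPRF (h : HardPRFInTC0OfSubexpDDH)`; that def was MERGED into
  the theorem (D-0026 split review): it is the one-line corollary of `HardPRFInTC0OfSubexpDDH`, not
  an independent proof obligation. The hypothesis-free statement is the term
  `naturalProofsTC0_of_subexpDDH hardPRFInTC0OfSubexpDDH_holds` as soon as that discharge lands.)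
  The dependents of `HardPRFInTC0` are re-threaded through `SubexpDDH` in the same way
  (`no_natural_proof_of_not_mem_TC0_of_subexpDDH`, `not_natural_useful_superset_TC0_of_subexpDDH`).

**The hypothesis here is STRONGER than the printed one.** Naor–Reingold state the remark of
p. 237 for the GDH assumption (§5.1, an oracle assumption; DDH ⟹ GDH by Cor. 5.1, and GDH modulo
a Blum integer follows from the hardness of factoring, §5.4), against subexponential-TIME
(uniform) adversaries; `SubexpDDH` is DDH against subexponential-SIZE circuits. So p. 237 must
not be cited as stating `naturalProofsTC0_of_subexpDDH` verbatim: the statements here have a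
stronger hypothesis and are therefore IMPLIED BY (weaker than) the printed GDH claim read
non-uniformly; the GDH/factoring variants need oracle adversaries and are left unformalised.

## Sources

* [NaorReingold2004] pp. 237, 242–243 (§3.2, Assumption 3.1), 245–246 (Construction 4.1,
  Thm. 4.1, Lemma 4.2, Thm. 4.3), 251–252 (§4.2, Thm. 4.5), §5 — held
  (`lit read paper:doi-10-1145-972639-972643`).
* [RazborovRudich1997] Thm. 4.1, §4 — through `Literature.Barriers.PneNP.NaturalProofsTC0`.
* [AroraBarakCC2009] Example 23.2 (PDF p. 587), §23.3 (PDF pp. 591–592), §23.4, Ch. 23 notes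
  (PDF p. 596) — held.
-/

noncomputable section

namespace Literature.Barriers.PneNP

open _root_.Computability Literature.Computability.Complexity Literature.Computability.MetaComplexity Literature.Computability.Cryptography Filter

/-! ### `HardPRFInTC0` is a hypothesis: what refutes it -/

/-- **`HardPRFInTC0` is refuted by any natural proof against `TC⁰`** (contrapositive of the
tree's proved `not_exists_natural_useful_TC0`): discharging `HardPRFInTC0` unconditionally would
rule out, unconditionally, every `P/poly`-natural property useful against `TC⁰` — e.g. it would
show that the property "circuit complexity `> n^{log n}`" (useful against every `n^c`, and large)
is not `P/poly`-constructive, which is open: that property is `P/poly`-constructive as soon as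
`NP ⊆ P/poly`, because `MCSP ∈ NP`. [cite: AroraBarakCC2009, Example 23.2 (PDF p. 587) and §23.3] [cite: KabanetsCai2000, §2] -/
theorem not_hardPRFInTC0_of_natural_useful
    (h : ∃ P : CombinatorialProperty, IsNatural PPoly P ∧ IsUsefulAgainst TC0 P) :
    ¬ HardPRFInTC0 :=
  fun hF => not_exists_natural_useful_TC0 hF h

/-! ### The corrected, conditional statement -/

/-- **Naor–Reingold's conditional existence of hard pseudo-random functions in `TC⁰` (the
corrected form of `HardPRFInTC0`).** If the decisional Diffie–Hellman assumption holds against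
subexponential-size circuits for some instance sequence `⟨P_m, Q_m, g_m⟩` (`SubexpDDH`:
`2^{m^δ}`-size `B₂`-circuits have advantage `< 2^{-m^δ}`), then there is a keyed family of Boolean
functions all of whose members lie in non-uniform `TC⁰` and whose truth-table generators are
superexponentially hard in the input length (`HardPRFInTC0`). DISCREPANCY: the tree's
`HardPRFInTC0` (same cite) asserts this consequent with no hypothesis; the source has the
hypothesis — Thm. 4.1 (p. 245, DDH ⟹ pseudo-randomness of `f_{P,Q,g,ā}(x) = (g^{a₀})^{∏_{xᵢ=1} aᵢ}`,
with the "moreover" of p. 246: time `poly(n)·t(n)`, advantage `ε(n)/n`), Lemma 4.2 / Thm. 4.3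
(p. 246, hashing the values to bit strings), Thm. 4.5 (p. 252, evaluation in `TC⁰` after
preprocessing of the key; `Literature.Computability.Cryptography.NaorReingold2004_thm45`), assembled with the
Razborov–Rudich coupling (restrict to `n = m^{δ/2}` input bits, so that `2^{O(n)}`-size
truth-table tests are `2^{o(m^δ)}`-size oracle adversaries). A named fact, not proved here;
the non-uniform subexponential DDH form is the one this assembly consumes (the source's
Assumption 3.1 is uniform and polynomial; its remark p. 237 says "against a subexponential-time
adversary"). [cite: NaorReingold2004, Thm. 4.1 (p. 245), Thm. 4.3 (p. 246), Thm. 4.5 (p. 252), p. 237] [cite: AroraBarakCC2009, §23.3 (PDF pp. 591–592)] -/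
def HardPRFInTC0OfSubexpDDH : Prop :=
  SubexpDDH → HardPRFInTC0

/-- The unconditional `HardPRFInTC0` trivially implies its conditional correction (the
correction is the weaker, printed statement). [cite: NaorReingold2004, p. 237] -/
theorem hardPRFInTC0OfSubexpDDH_of_hardPRFInTC0 (h : HardPRFInTC0) : HardPRFInTC0OfSubexpDDH :=
  fun _ => h

/-! ### The barrier as printed on p. 237 (DDH form): a theorem relative to `HardPRFInTC0OfSubexpDDH` -/

/-- **No natural proofs against `TC⁰` under subexponential DDH (Naor–Reingold 2004, p. 237, with
Razborov–Rudich 1997).** "if a circuit class contains pseudo-random functions (that are secure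
against a subexponential-time adversary), then there are no … Natural Proofs … for separating
this class from P/poly. We therefore get from our construction that if the GDH-Assumption holds
against a subexponential-time adversary (and in particular if factoring is sufficiently hard),
then there are no Natural Proofs for separating `TC⁰` from P/poly." Here with the STRONGER
hypothesis `SubexpDDH` (DDH, not GDH — DDH implies GDH, Cor. 5.1 — and non-uniform
subexponential-size adversaries), hence a consequence of the printed remark rather than its
verbatim content: `SubexpDDH → ¬ ∃ P, IsNatural PPoly P ∧ IsUsefulAgainst TC0 P`, PROVED RELATIVE TO
the named fact `HardPRFInTC0OfSubexpDDH` (the hypothesis `h`; Naor–Reingold's Thms. 4.1, 4.3, 4.5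
with the Razborov–Rudich coupling) from the tree's proved class-relative Razborov–Rudich theorem
`naturalProofsTC0_holds` / `not_exists_natural_useful_TC0`. Formerly also recorded as the named
fact `NaturalProofsTC0OfSubexpDDH`, merged into this theorem (it was the one-line corollary of
`HardPRFInTC0OfSubexpDDH`); the hypothesis-free form is
`naturalProofsTC0_of_subexpDDH hardPRFInTC0OfSubexpDDH_holds` once that discharge lands.

BARRIER
technique_class: natural-proofs-against-tc0 — `P/poly`-constructive, `2^{-O(n)}`-large combinatorial properties of Boolean functions (`IsNatural PPoly`) useful against non-uniform `TC⁰` (`IsUsefulAgainst TC0`), the class of Razborov–Rudich natural lower-bound arguments aimed at constant-depth threshold circuits [cite: NaorReingold2004, p. 237] [cite: AroraBarakCC2009, §23.1–23.2 (PDF pp. 586–590)].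
blocks: natural proofs of `L ∉ TC⁰` for any explicit `L`, in particular of route PneNP/Circuit's crux #5 `¬ NP ⊆ TC0` (and of `NP ⊄ ACC⁰` only through properties useful against all of `TC⁰`), CONDITIONALLY on `SubexpDDH` — "there are no Natural Proofs for separating `TC⁰` from P/poly" [cite: NaorReingold2004, p. 237]; natural proofs "will probably not allow us to separate even `TC⁰` from `P`" [cite: AroraBarakCC2009, Ch. 23 notes (PDF p. 596)].
because: under DDH the functions `f_{P,Q,g,ā}` are pseudo-random with a linear-preserving reduction (a `t(n)`-time distinguisher of advantage `ε` gives a `poly(n)·t(n)`-time DDH breaker of advantage `ε/n`) [cite: NaorReingold2004, Thm. 4.1 and Remark 4.1 (pp. 245–246)], hash to pseudo-random bits [cite: NaorReingold2004, Lemma 4.2 and Thm. 4.3 (p. 246)] and are evaluated in `TC⁰` by two multiple products after preprocessing `g^{2^i}` [cite: NaorReingold2004, §4.2 and Thm. 4.5 (pp. 251–252)]; a natural property useful against `TC⁰` is a `2^{O(n)}`-size test of advantage `2^{-O(n)}` on truth tables rejecting every member of a `TC⁰` family (in-tree: `not_natural_useful_of_hardPRF`), i.e. a subexponential distinguisher once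 `n = m^{δ/2}` [cite: AroraBarakCC2009, §23.3 (PDF pp. 591–592)].
evasions_known: arguments violating largeness or constructivity — diagonalization, counting, the non-natural `MA_EXP`/`PromiseMA` lower bounds [cite: AroraBarakCC2009, §23.4 (PDF pp. 592–594)]; the algorithmic method (`NTIME[2ⁿ] ⊄ ACC⁰`, non-natural by diagonalization; "little evidence that ACC contains pseudorandom function generators") [cite: Williams2014, Thm. 1.1 (p. 3) and p. 7]; properties useful only against subclasses of `TC⁰` too weak to evaluate the functions, e.g. depth two: "pseudo-random functions cannot be evaluated in `TC⁰₂`" (Krause–Lucks) while depth four suffices [cite: NaorReingold2004, §4.2.1 (p. 252)].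
scope_caveats: CONDITIONAL on `SubexpDDH`, the decisional Diffie–Hellman assumption in prime-order subgroups of `ℤ_P^*` against NON-UNIFORM circuits of size `2^{m^δ}` (advantage `< 2^{-m^δ}`) for some instance sequence — stronger than the printed uniform, polynomial Assumption 3.1 [cite: NaorReingold2004, Assumption 3.1 (p. 243)]; the printed remark assumes only GDH against subexponential adversaries (weaker than DDH, Cor. 5.1; implied by hardness of factoring Blum integers, §5.4), whose oracle form is NOT formalised, so the factoring-based version is not covered [cite: NaorReingold2004, §5.1 and p. 237]; the implication `HardPRFInTC0OfSubexpDDH` is a named fact (hypothesis `h`), not yet proved in-tree (Thm. 4.5 is: `NaorReingold2004_thm45_holds`; the truth-table form of Thms. 4.1/4.3 is `abs_uProb_seedTable_sub_uniform_le`; the assembly is pending); naturality/usefulness are the tree's `IsNatural PPoly` (largeness `2^{-O(n)}`) and language-form `IsUsefulAgainst TC0`; nothing is claimed for uniform `TC⁰` or for properties useful against proper subclasses.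
status: established (conditional result in print; the hypothesis is a standard cryptographic assumption, open) [cite: NaorReingold2004, p. 237] [cite: AroraBarakCC2009, Ch. 23 notes (PDF p. 596)] -/
theorem naturalProofsTC0_of_subexpDDH (h : HardPRFInTC0OfSubexpDDH) (hd : SubexpDDH) :
    ¬ ∃ P : CombinatorialProperty, IsNatural PPoly P ∧ IsUsefulAgainst TC0 P :=
  not_exists_natural_useful_TC0 (h hd)

/-- Route-facing reading, re-threaded through the cryptographic assumption: under subexponential
DDH no natural property certifies `L ∉ TC⁰` for any language `L` (in particular none certifies
`NP ⊄ TC⁰` via an `NP` language with slices in the property infinitely often).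
[cite: NaorReingold2004, p. 237] -/
theorem no_natural_proof_of_not_mem_TC0_of_subexpDDH (h : HardPRFInTC0OfSubexpDDH)
    (hd : SubexpDDH) (L : Language Bool) :
    ¬ ∃ P : CombinatorialProperty, IsNatural PPoly P ∧ IsUsefulAgainst TC0 P ∧
        ∃ᶠ n in atTop, L.sliceFn n ∈ P n :=
  no_natural_proof_of_not_mem_TC0 (h hd) L

/-- Under subexponential DDH there is no natural proof against any class `Λ ⊇ TC⁰` either
(usefulness against `Λ` implies usefulness against `TC⁰`) — "no Natural Proofs for separating
`TC⁰`", a fortiori none for separating larger classes, "from P/poly". [cite: NaorReingold2004, p. 237] -/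
theorem not_natural_useful_superset_TC0_of_subexpDDH (h : HardPRFInTC0OfSubexpDDH)
    (hd : SubexpDDH) {Λ : Set (Language Bool)} (hΛ : TC0 ⊆ Λ) :
    ¬ ∃ P : CombinatorialProperty, IsNatural PPoly P ∧ IsUsefulAgainst Λ P := by
  obtain ⟨key, F, hF, hH⟩ := h hd
  exact not_natural_useful_of_hardPRF_of_subset hΛ hF hH

end Literature.Barriers.PneNP

end
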